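import Literature.Analysis.SpecialFunctions.DilogarithmProofs
import HarnessLib

/-!
# Landen's transformation of the real dilogarithm series

Topic `Literature/Analysis/SpecialFunctions`; a pure-proof companion of `Dilogarithm.lean` /
`DilogarithmProofs.lean` (no new definitions, no named facts). We prove **Landen's transformation**
(Andrews–Askey–Roy 1999, Theorem 2.6.1: "`Li₂(x) + Li₂(x/(x−1)) = −½[log(1−x)]²`")

  `realDilog x + realDilog (x/(x−1)) = −½ (log(1 − x))²`    for `|x| < 1/2`,

for the series dilogarithm `realDilog t = Σ_{n≥1} tⁿ/n²` of `Dilogarithm.lean`, on the range `|x| < 1/2`,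
where both arguments `x` and `x/(x−1) = −x/(1−x)` lie in `(−1, 1)` so that each `Li₂` is its convergent
series. (The printed identity holds for all `x < 1` by analytic continuation; we vend the series range, which
contains the values `x = 1/q`, `q` an integer with `|q| ≥ 3`, used in Diophantine applications:
`Li₂(1/q) + Li₂(1/(1−q)) = −½ log²(1 − 1/q)`.)

Proof ("there is another proof in Exercise 38", loc. cit. — by differentiation, exactly as the five-term
equation is proved in `DilogarithmProofs.lean`): on `(−1/2, 1/2)` both sides are differentiable, the
derivatives agree — `Li₂'(u) = −log(1−u)/u`, `(x/(x−1))' = −1/(x−1)²`, `1 − x/(x−1) = 1/(1−x)`, whence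
`d/dx [Li₂(x) + Li₂(x/(x−1))] = −log(1−x)/x + log(1−x)/(x(1−x)) = log(1−x)/(1−x) = d/dx[−½ log²(1−x)]` —
and both sides vanish at `x = 0`.

## References

* G. E. Andrews, R. Askey, R. Roy, *Special Functions*, Encyclopedia Math. Appl. 71, Cambridge Univ. Press
  (1999), §2.6, Theorem 2.6.1 (Landen's transformation), Exercise 2.38. [AndrewsAskeyRoy1999]
-/

noncomputable section

namespace Literature.Analysis.SpecialFunctions

/-- For `|x| < 1/2`: `x/(x−1) = −(x/(1−x))`. [folklore] -/
theorem landen_arg_eq_neg (x : ℝ) : x / (x - 1) = -(x / (1 - x)) := by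
  rw [← neg_sub 1 x, div_neg]

/-- For `|x| < 1/2` the Landen argument `x/(x−1)` lies in `(−1, 1)`. [folklore] -/
theorem abs_landen_arg_lt_one {x : ℝ} (hx : |x| < 1 / 2) : |x / (x - 1)| < 1 := by
  rw [landen_arg_eq_neg, abs_neg]
  exact abs_div_one_sub_lt_one hx hx

/-- `1 − x/(x−1) = 1/(1−x)` (for `x ≠ 1`). [folklore] -/
theorem one_sub_landen_arg {x : ℝ} (hx : x ≠ 1) : 1 - x / (x - 1) = 1 / (1 - x) := by
  have h : x - 1 ≠ 0 := sub_ne_zero.2 hx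
  have h' : (1 : ℝ) - x ≠ 0 := sub_ne_zero.2 (Ne.symm hx)
  field_simp
  ring

/-- The `x`-derivative of the left side `Li₂(x) + Li₂(x/(x−1))` of Landen's transformation on
`|x| < 1/2` (chain rule, `(x/(x−1))' = −1/(x−1)²`). [folklore] -/
theorem hasDerivAt_landen_lhs {x : ℝ} (hx : |x| < 1 / 2) :
    HasDerivAt (fun x => realDilog x + realDilog (x / (x - 1)))
      ((∑' n : ℕ, x ^ n / ((n : ℝ) + 1))
        + (∑' n : ℕ, (x / (x - 1)) ^ n / ((n : ℝ) + 1)) * (-1 / (x - 1) ^ 2)) x := by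
  have hx' := abs_lt.1 hx
  have h1x : x - 1 ≠ 0 := (show x - 1 < 0 by linarith).ne
  have hD : HasDerivAt realDilog (∑' n : ℕ, x ^ n / ((n : ℝ) + 1)) x :=
    hasDerivAt_realDilog (hx.trans (by norm_num))
  have hin : HasDerivAt (fun x => x / (x - 1)) (-1 / (x - 1) ^ 2) x := by
    refine ((hasDerivAt_id' x).fun_div ((hasDerivAt_id' x).sub_const 1) h1x).congr_deriv ?_
    ring
  have hU : HasDerivAt (fun x => realDilog (x / (x - 1)))
      ((∑' n : ℕ, (x / (x - 1)) ^ n / ((n : ℝ) + 1)) * (-1 / (x - 1) ^ 2)) x := by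
    exact (hasDerivAt_realDilog (abs_landen_arg_lt_one hx)).comp x hin
  exact hD.add hU

/-- The `x`-derivative of the right side `−½ log²(1−x)` of Landen's transformation, written as
`−½ (log(1−x)·log(1−x))` (product rule, `(log(1−x))' = −1/(1−x)`). [folklore] -/
theorem hasDerivAt_landen_rhs {x : ℝ} (hx : |x| < 1 / 2) :
    HasDerivAt (fun x => -(1 / 2) * (Real.log (1 - x) * Real.log (1 - x)))
      (-(1 / 2) * ((-1) / (1 - x) * Real.log (1 - x) + Real.log (1 - x) * ((-1) / (1 - x)))) x := by
  have hx' := abs_lt.1 hx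
  have h1x : (1 : ℝ) - x ≠ 0 := (show (0 : ℝ) < 1 - x by linarith).ne'
  have hL : HasDerivAt (fun x => Real.log (1 - x)) ((-1) / (1 - x)) x :=
    ((hasDerivAt_id' x).const_sub 1).log h1x
  exact (hL.mul hL).const_mul _

/-- **The derivative identity behind Landen's transformation** on `|x| < 1/2`: for `x ≠ 0` it is
`−log(1−x)/x + (log(1−x)(x−1)/x)·(−1/(x−1)²) = log(1−x)/(1−x)` (using `u·Li₂'(u) = −log(1−u)` at
`u = x` and at `u = x/(x−1)`, where `1 − u = 1/(1−x)`); at `x = 0` both sides vanish (`Li₂'(0) = 1`).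
[folklore] -/
theorem landen_deriv_eq {x : ℝ} (hx : |x| < 1 / 2) :
    (∑' n : ℕ, x ^ n / ((n : ℝ) + 1))
        + (∑' n : ℕ, (x / (x - 1)) ^ n / ((n : ℝ) + 1)) * (-1 / (x - 1) ^ 2)
      = -(1 / 2) * ((-1) / (1 - x) * Real.log (1 - x) + Real.log (1 - x) * ((-1) / (1 - x))) := by
  have hx' := abs_lt.1 hx
  have h1x : (0 : ℝ) < 1 - x := by linarith
  have h1x0 : (1 : ℝ) - x ≠ 0 := h1x.ne'
  have hx1 : x ≠ 1 := by rintro rfl; norm_num at hx'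
  have hxm1 : x - 1 ≠ 0 := sub_ne_zero.2 hx1
  -- `u · Li₂'(u) = -log(1 - u) = log(1 - x)` at `u = x/(x-1)`
  have hU := mul_realDilogDerivSeries (abs_landen_arg_lt_one hx)
  have elogU : Real.log (1 - x / (x - 1)) = -Real.log (1 - x) := by
    rw [one_sub_landen_arg hx1, one_div, Real.log_inv]
  rw [elogU, neg_neg] at hU
  rcases eq_or_ne x 0 with rfl | hx0
  · -- `x = 0`: `Li₂'(0) = 1`, `u = 0`, `log 1 = 0`
    simp [realDilogDerivSeries_zero]
  · have hu0 : x / (x - 1) ≠ 0 := div_ne_zero hx0 hxm1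
    have hD := mul_realDilogDerivSeries (hx.trans (by norm_num))
    rw [(eq_div_iff hu0).2 ((mul_comm _ _).trans hU), (eq_div_iff hx0).2 ((mul_comm _ _).trans hD)]
    field_simp
    ring

/-- Landen's transformation as an identity of functions on `(−1/2, 1/2)`: both sides are differentiable
there with equal derivatives (`landen_deriv_eq`) and both vanish at `0`.
[cite: AndrewsAskeyRoy1999, Thm 2.6.1] -/
theorem landen_eqOn :
    (Set.Ioo (-(1 / 2)) (1 / 2) : Set ℝ).EqOn (fun x => realDilog x + realDilog (x / (x - 1)))
      (fun x => -(1 / 2) * (Real.log (1 - x) * Real.log (1 - x))) := by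
  have hmem : ∀ x : ℝ, x ∈ (Set.Ioo (-(1 / 2)) (1 / 2) : Set ℝ) → |x| < 1 / 2 :=
    fun x hx => abs_lt.2 hx
  refine IsOpen.eqOn_of_deriv_eq isOpen_Ioo (convex_Ioo _ _).isPreconnected ?_ ?_ ?_
    (show (0 : ℝ) ∈ Set.Ioo (-(1 / 2)) (1 / 2) from ⟨by norm_num, by norm_num⟩) ?_
  · intro x hx
    exact (hasDerivAt_landen_lhs (hmem x hx)).differentiableAt.differentiableWithinAt
  · intro x hx
    exact (hasDerivAt_landen_rhs (hmem x hx)).differentiableAt.differentiableWithinAt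
  · intro x hx
    rw [(hasDerivAt_landen_lhs (hmem x hx)).deriv, (hasDerivAt_landen_rhs (hmem x hx)).deriv]
    exact landen_deriv_eq (hmem x hx)
  · simp [realDilog_zero]

/-- **Landen's transformation of the dilogarithm** (Andrews–Askey–Roy 1999, Theorem 2.6.1:
"`Li₂(x) + Li₂(x/(x−1)) = −½[log(1−x)]²`"), for the series dilogarithm `realDilog` on the range
`|x| < 1/2` where both series converge. [cite: AndrewsAskeyRoy1999, Thm 2.6.1] -/
theorem realDilog_add_realDilog_landen {x : ℝ} (hx : |x| < 1 / 2) :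
    realDilog x + realDilog (x / (x - 1)) = -(1 / 2) * Real.log (1 - x) ^ 2 := by
  have h := landen_eqOn (Set.mem_Ioo.2 (abs_lt.1 hx))
  simp only at h
  rw [h, sq]

/-- Landen's transformation in the form `Li₂(x) + Li₂(−x/(1−x)) = −½ log²(1−x)`, `|x| < 1/2`.
[cite: AndrewsAskeyRoy1999, Thm 2.6.1] -/
theorem realDilog_add_realDilog_neg_div_one_sub {x : ℝ} (hx : |x| < 1 / 2) :
    realDilog x + realDilog (-(x / (1 - x))) = -(1 / 2) * Real.log (1 - x) ^ 2 := by
  rw [← landen_arg_eq_neg]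
  exact realDilog_add_realDilog_landen hx

/-- Landen's transformation at `x = 1/q` for an integer `q` with `|q| ≥ 3` (so `|1/q| < 1/2`):
`Li₂(1/q) + Li₂(1/(1−q)) = −½ log²(1 − 1/q)` — the "Landen join" of the levels `q` and `1 − q`.
[cite: AndrewsAskeyRoy1999, Thm 2.6.1] -/
theorem realDilog_inv_add_realDilog_inv_one_sub {q : ℝ} (hq : 2 < |q|) :
    realDilog (1 / q) + realDilog (1 / (1 - q)) = -(1 / 2) * Real.log (1 - 1 / q) ^ 2 := by
  have hq0 : q ≠ 0 := by rintro rfl; norm_num at hq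
  have hx : |1 / q| < 1 / 2 := by
    rw [abs_div, abs_one]
    exact one_div_lt_one_div_of_lt two_pos hq
  have harg : 1 / q / (1 / q - 1) = 1 / (1 - q) := by
    have h1q : 1 - q ≠ 0 := by
      intro h
      have : q = 1 := by linarith
      rw [this] at hq; norm_num at hq
    field_simp
  rw [← harg]
  exact realDilog_add_realDilog_landen hx

end Literature.Analysis.SpecialFunctions

end
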